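import Summits.Ventures.PercRepro.RankLevelSetLevelSixBasisSq24Free9
import Summits.Ventures.PercRepro.RankLevelSetLevelSixBasisSq24Free10
import Summits.Ventures.PercRepro.RankLevelSetLevelSixBasisSq23S9
import Summits.Ventures.PercRepro.RankLevelSetLevelSixBasisSq23S10
import Summits.Ventures.PercRepro.RankLevelSetLevelSixBasisSq22S9
import Summits.Ventures.PercRepro.RankLevelSetLevelSixBasisSq22S10
import Summits.Ventures.PercRepro.RankLevelSetLevelSixBasisSq21S10
import Summits.Ventures.PercRepro.S2CoreSeventeenSplit
import Summits.Ventures.PercRepro.RankLevelSetCoreSixColoopFree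
import Summits.Ventures.PercRepro.S3SixWindow

/-!
# PercRepro — THE 24 ROW, THE CELLS `(24, 9)` AND `(24, 10)` BY THE TWO- AND THREE-LEVEL COLOOP SPLITS (p8 g10, S3)

`proofs/SUBCLAIM-S3-p8.md` §3x. `(24, 9)`: a coloop-free core by `c025_core_six_basis_sq24_free9` (`0.900`); a coloop `e` by
`RLS_of_coloop_scaled` on the scaled cell at rank `23` on `M ∖ e` — coloop-free `c025_core_six_scaled_basis_sq23s9` (`0.801`),
a coloop `e'` by `weighted_of_isColoop_scaled` on the twice-scaled cell `c025_core_six_scaled2_basis_sq22s9` at rank `22`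
(`0.973`, every core). `(24, 10)`: the same with a THIRD level — `c025_core_six_basis_sq24_free10` (`0.852`),
`c025_core_six_scaled_basis_sq23s10` (`0.781`), the twice-scaled coloop-free `c025_core_six_scaled2_basis_sq22s10` (`0.718`),
and a third coloop `e''` by `weighted_of_isColoop_scaled` again on the thrice-scaled cell `c025_core_six_scaled3_basis_sq21s10`
at rank `21` (`Φ(24, 6)/8`, `0.970`, every core). Axioms: standard.
-/

open scoped Matroid

namespace PercRepro

namespace ThmN

open Set

variable {α : Type}

/-- **The scaled cell on EVERY `e`-free core of rank `23`, corank `9`.** -/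
theorem c025_core_six_scaled_basis_sq23_all9 (M : Matroid α) [M.Finite]
    (hR : M.eRank = (23 : ℕ∞)) (hn : M.E.ncard = 23 + 9)
    (hfree : ∀ e ∈ M.E, ∃ A ⊆ M.E \ {e}, e ∉ M.closure A ∧ e ∉ M.closure ((M.E \ {e}) \ A)) :
    phiK (23 + 1) 6 / 2 * (Matroid.topCount M 23 6 : ℚ) ≤ (Matroid.midCount M 23 6 : ℚ) := by
  by_cases hc : ∃ e ∈ M.E, M.IsColoop e
  · obtain ⟨e, _, hce⟩ := hc
    have hR' : M.eRank = ((22 + 1 : ℕ) : ℕ∞) := by rw [hR]; norm_num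
    obtain ⟨hn22, hR22, hfree22, -⟩ := delete_core_data M hce hR' (by omega) hfree
    have h := c025_core_six_scaled2_basis_sq22s9 (M ＼ {e}) 22 (le_refl 22) hR22 hn22 hfree22
    have h' : phiK (23 + 1) 6 / 2 / 2 * (Matroid.topCount (M ＼ {e}) 22 6 : ℚ) ≤
        (Matroid.midCount (M ＼ {e}) 22 6 : ℚ) := by
      have e1 : phiK (23 + 1) 6 / 2 / 2 = phiK (22 + 2) 6 / 4 := by
        rw [show (23 + 1 : ℕ) = 22 + 2 by norm_num]; ring
      rw [e1]; exact h
    exact weighted_of_isColoop_scaled M hce (by norm_num) hR' (phiK (23 + 1) 6 / 2) h'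
  · exact c025_core_six_scaled_basis_sq23s9 M 23 (le_refl 23) (fun e he hce => hc ⟨e, he, hce⟩) hR hn hfree

/-- **The core cell `(24, 9)`, every `e`-free core.** -/
theorem c025_core_six_twentyfour_nine (M : Matroid α) [M.Finite]
    (hR : M.eRank = (24 : ℕ∞)) (hn : M.E.ncard = 24 + 9)
    (hfree : ∀ e ∈ M.E, ∃ A ⊆ M.E \ {e}, e ∉ M.closure A ∧ e ∉ M.closure ((M.E \ {e}) \ A)) :
    RLS M 24 6 := by
  by_cases hc : ∃ e ∈ M.E, M.IsColoop e
  · obtain ⟨e, _, hce⟩ := hc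
    have hR' : M.eRank = ((23 + 1 : ℕ) : ℕ∞) := by rw [hR]; norm_num
    obtain ⟨hn23, hR23, hfree23, -⟩ := delete_core_data M hce hR' (by omega) hfree
    exact RLS_of_coloop_scaled M hce (by norm_num) hR'
      (c025_core_six_scaled_basis_sq23_all9 (M ＼ {e}) hR23 hn23 hfree23)
  · exact c025_core_six_basis_sq24_free9 M 24 (le_refl 24) (fun e he hce => hc ⟨e, he, hce⟩) hR hn hfree

/-- **The twice-scaled cell on EVERY `e`-free core of rank `22`, corank `10`** (level two of the three-level split). -/
theorem c025_core_six_scaled2_basis_sq22_all10 (M : Matroid α) [M.Finite]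
    (hR : M.eRank = (22 : ℕ∞)) (hn : M.E.ncard = 22 + 10)
    (hfree : ∀ e ∈ M.E, ∃ A ⊆ M.E \ {e}, e ∉ M.closure A ∧ e ∉ M.closure ((M.E \ {e}) \ A)) :
    phiK (22 + 2) 6 / 4 * (Matroid.topCount M 22 6 : ℚ) ≤ (Matroid.midCount M 22 6 : ℚ) := by
  by_cases hc : ∃ e ∈ M.E, M.IsColoop e
  · obtain ⟨e, _, hce⟩ := hc
    have hR' : M.eRank = ((21 + 1 : ℕ) : ℕ∞) := by rw [hR]; norm_num
    obtain ⟨hn21, hR21, hfree21, -⟩ := delete_core_data M hce hR' (by omega) hfree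
    have h := c025_core_six_scaled3_basis_sq21s10 (M ＼ {e}) 21 (le_refl 21) hR21 hn21 hfree21
    have h' : phiK (22 + 2) 6 / 4 / 2 * (Matroid.topCount (M ＼ {e}) 21 6 : ℚ) ≤
        (Matroid.midCount (M ＼ {e}) 21 6 : ℚ) := by
      have e1 : phiK (22 + 2) 6 / 4 / 2 = phiK (21 + 3) 6 / 8 := by
        rw [show (22 + 2 : ℕ) = 21 + 3 by norm_num]; ring
      rw [e1]; exact h
    exact weighted_of_isColoop_scaled M hce (by norm_num) hR' (phiK (22 + 2) 6 / 4) h'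
  · exact c025_core_six_scaled2_basis_sq22s10 M 22 (le_refl 22) (fun e he hce => hc ⟨e, he, hce⟩) hR hn hfree

/-- **The scaled cell on EVERY `e`-free core of rank `23`, corank `10`** (level one of the three-level split). -/
theorem c025_core_six_scaled_basis_sq23_all10 (M : Matroid α) [M.Finite]
    (hR : M.eRank = (23 : ℕ∞)) (hn : M.E.ncard = 23 + 10)
    (hfree : ∀ e ∈ M.E, ∃ A ⊆ M.E \ {e}, e ∉ M.closure A ∧ e ∉ M.closure ((M.E \ {e}) \ A)) :
    phiK (23 + 1) 6 / 2 * (Matroid.topCount M 23 6 : ℚ) ≤ (Matroid.midCount M 23 6 : ℚ) := by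
  by_cases hc : ∃ e ∈ M.E, M.IsColoop e
  · obtain ⟨e, _, hce⟩ := hc
    have hR' : M.eRank = ((22 + 1 : ℕ) : ℕ∞) := by rw [hR]; norm_num
    obtain ⟨hn22, hR22, hfree22, -⟩ := delete_core_data M hce hR' (by omega) hfree
    have h := c025_core_six_scaled2_basis_sq22_all10 (M ＼ {e}) hR22 hn22 hfree22
    have h' : phiK (23 + 1) 6 / 2 / 2 * (Matroid.topCount (M ＼ {e}) 22 6 : ℚ) ≤
        (Matroid.midCount (M ＼ {e}) 22 6 : ℚ) := by
      have e1 : phiK (23 + 1) 6 / 2 / 2 = phiK (22 + 2) 6 / 4 := by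
        rw [show (23 + 1 : ℕ) = 22 + 2 by norm_num]; ring
      rw [e1]; exact h
    exact weighted_of_isColoop_scaled M hce (by norm_num) hR' (phiK (23 + 1) 6 / 2) h'
  · exact c025_core_six_scaled_basis_sq23s10 M 23 (le_refl 23) (fun e he hce => hc ⟨e, he, hce⟩) hR hn hfree

/-- **The core cell `(24, 10)`, every `e`-free core, by the three-level coloop split.** -/
theorem c025_core_six_twentyfour_ten (M : Matroid α) [M.Finite]
    (hR : M.eRank = (24 : ℕ∞)) (hn : M.E.ncard = 24 + 10)
    (hfree : ∀ e ∈ M.E, ∃ A ⊆ M.E \ {e}, e ∉ M.closure A ∧ e ∉ M.closure ((M.E \ {e}) \ A)) :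
    RLS M 24 6 := by
  by_cases hc : ∃ e ∈ M.E, M.IsColoop e
  · obtain ⟨e, _, hce⟩ := hc
    have hR' : M.eRank = ((23 + 1 : ℕ) : ℕ∞) := by rw [hR]; norm_num
    obtain ⟨hn23, hR23, hfree23, -⟩ := delete_core_data M hce hR' (by omega) hfree
    exact RLS_of_coloop_scaled M hce (by norm_num) hR'
      (c025_core_six_scaled_basis_sq23_all10 (M ＼ {e}) hR23 hn23 hfree23)
  · exact c025_core_six_basis_sq24_free10 M 24 (le_refl 24) (fun e he hce => hc ⟨e, he, hce⟩) hR hn hfree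

end ThmN

end PercRepro
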